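import Summits.AtomisticToContinuum.FouriersLaw.Theorems.EmbeddedDrudeMourreGreenKuboContinuationCurrentVariancePos
import Summits.AtomisticToContinuum.FouriersLaw.Theorems.EmbeddedDrudeMourreDrudeDissolutionStubPencilFrameworkDynamics
import Literature.MathematicalPhysics.KineticTheory.InfiniteChainShiftInvariantUniqueness

/-!
# NC `gibbs_currentAutocov_three_pos`: the three-bond static current covariance is positive
(crux `LocalOhmBV.LocalOhm`, item stmt-AtomisticToContinuum-12009, line `registered`/birth, cycle-2 calibration
helper NC of the harmonic-corner calibration; `--supports` file)

For `P = pinnedChain ω₂ lam β γ` (`ω₂ > 0`, `lam, β ≥ 0`, any `γ`), `T > 0` and a shift-invariant DLR Gibbs state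
`μ` at `T`:
`0 < c := ∫ j_0² dμ + 2 ∫ j_0 j_1 dμ`,
the normalisation of the conserved-current functional `Λ_J = Σ_z Cov(·, j_z)/c` of the line (and the static part of
the current Drude weight `Σ_z Cov(j_0, j_z)`).

Proof (`integral_bondCurrentZ_sq_add_two_mul_pos`, stated for any chain with `U ≥ 0` continuous, `V` an even
non-negative polynomial of degree `≥ 2` with `V'` "odd-injective", and a superstable shift-invariant DLR state).
The static covariances `x ↦ ∫ j_0 j_x dμ` live on `x ∈ {-1, 0, 1}`
(`IsChainGibbsMeasure.tsum_integral_bondCurrentZ_mul`) and `∫ j_0 j_{-1} = ∫ j_0 j_1` by shift invariance, so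
`c = ∑_x ∫ j_0 j_x dμ = (T/4) ∫ (V'(r_0) + V'(r_1))² dμ` (`r_x = q_{x+1} - q_x`;
`IsChainGibbsMeasure.tsum_integral_bondCurrentZ_mul_eq` of
`Literature/MathematicalPhysics/KineticTheory/InfiniteChainStaticCurrentVariance.lean`), the finitely many
moments involved being integrable under Buttà–Marchioro's superstability estimate
(`exists_moment_bounds_of_hasSuperstabilityEstimate` of
`…EmbeddedDrudeMourreGreenKuboContinuationCurrentVariancePos`), which every shift-invariant DLR state of the
pinned chain obeys (`OscillatorChain.hasSuperstabilityEstimate_of_isShiftInvariant_pinnedChain`, `lam, β ≥ 0`).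
The integrand `(V'(r_0) + V'(r_1))²` is `≥ 0` and vanishes only where `r_0 + r_1 = q_2 - q_0 = 0`
(`V'(r) = r + βr³` odd and injective, `pinnedChain_deriv_V_add_eq_zero`), a `μ`-null event
(`IsChainGibbsMeasure.measure_fst_eq_fst`), exactly as in `currentCorrelation_zero_pos` of that file (which is
the same statement packaged through a `μ`-preserving dynamics `D`, not available here). The harmonic endpoint
`β = 0` is covered by the degree bookkeeping `exists_isEvenPolyOfDegree_V_pinnedChain` of
`…EmbeddedDrudeMourreDrudeDissolutionStubPencilFrameworkDynamics` (`V = r²/2` is an even polynomial of degree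
`2·1`). No definitions.
-/

set_option autoImplicit false

noncomputable section

namespace Summit.AtomisticToContinuum.FouriersLaw.Theorems.LocalOhmBirth

open MeasureTheory Filter Topology
open scoped BigOperators ENNReal
open Literature.MathematicalPhysics.KineticTheory
open Literature.MathematicalPhysics.KineticTheory.HeatConduction
open Summit.AtomisticToContinuum.FouriersLaw.Theorems.GreenKuboContinuation.TemperatureBlindVitaliHurwitz
  (exists_moment_bounds_of_hasSuperstabilityEstimate pinnedChain_deriv_V_add_eq_zero)
open Summit.AtomisticToContinuum.FouriersLaw.Theorems.DrudeDissolution.GramPencilHarmonicChaos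
  (exists_isEvenPolyOfDegree_V_pinnedChain)

/-- **Positivity of the three-bond static current covariance.** For a chain with `U ≥ 0` continuous, `V` an
even non-negative polynomial of degree `2s₂ ≥ 2` whose derivative is "odd-injective"
(`V'(r) + V'(r') = 0 ⟹ r + r' = 0`), and a shift-invariant DLR state `μ` at `T > 0` obeying the superstability
estimate (2.3): `0 < ∫ j_0² dμ + 2 ∫ j_0 j_1 dμ`. Indeed `∫ j_0 j_{-1} = ∫ j_0 j_1` (shift invariance), so the
left side is the three-term static sum `∑_x ∫ j_0 j_x dμ = (T/4) ∫ (V'(r_0) + V'(r_1))² dμ`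
(`tsum_integral_bondCurrentZ_mul`, `tsum_integral_bondCurrentZ_mul_eq`, the moments being integrable by
`exists_moment_bounds_of_hasSuperstabilityEstimate`); the integrand is non-negative and vanishes only if
`r_0 + r_1 = q_2 - q_0 = 0`, a `μ`-null event (`measure_fst_eq_fst`). [folklore] -/
theorem integral_bondCurrentZ_sq_add_two_mul_pos {P : OscillatorChain} {s₂ : ℕ} (h₂ : 1 ≤ s₂)
    (hU0 : ∀ r, 0 ≤ P.U r) (hU : Continuous P.U) (hVp : OscillatorChain.IsEvenPolyOfDegree P.V s₂)
    (hVinj : ∀ r r' : ℝ, deriv P.V r + deriv P.V r' = 0 → r + r' = 0)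
    {T : ℝ} (hT : 0 < T) {μ : Measure ChainConfig}
    (hμ : P.IsChainGibbsMeasure T μ) (hshift : IsShiftInvariant μ) (hss : P.HasSuperstabilityEstimate μ) :
    0 < (∫ σ, P.bondCurrentZ σ 0 ^ 2 ∂μ) + 2 * ∫ σ, P.bondCurrentZ σ 0 * P.bondCurrentZ σ 1 ∂μ := by
  -- adapted from `GreenKuboContinuation.TemperatureBlindVitaliHurwitz.currentCorrelation_zero_pos`
  haveI : IsProbabilityMeasure μ := hμ.1
  have hV : Continuous P.V := hVp.continuous
  have hV0 : ∀ r, 0 ≤ P.V r := hVp.choose_spec.2.2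
  obtain ⟨c, hc, ha, hb, hI⟩ :=
    exists_moment_bounds_of_hasSuperstabilityEstimate h₂ hU0 hU.measurable hVp hss
  have hq : ∀ x : ℤ, Measurable fun σ : ChainConfig => (σ x).1 := fun x =>
    (measurable_pi_apply x).fst
  have ham : Measurable fun σ : ChainConfig => deriv P.V ((σ 1).1 - (σ 0).1) :=
    (measurable_deriv P.V).comp ((hq 1).sub (hq 0))
  have hbm : Measurable fun σ : ChainConfig => deriv P.V ((σ 2).1 - (σ 1).1) :=
    (measurable_deriv P.V).comp ((hq 2).sub (hq 1))
  have hW0 : ∀ σ : ChainConfig, 0 ≤ P.bmLocalEnergy 0 2 σ := fun σ =>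
    zero_le_one.trans (OscillatorChain.one_le_bmLocalEnergy hU0 hV0 0 2 σ)
  -- the three position observables and their bounds by `W²`
  have e_a2 : ∀ σ : ChainConfig, |deriv P.V ((σ 1).1 - (σ 0).1) ^ 2| ≤
      c ^ 2 * P.bmLocalEnergy 0 2 σ ^ 2 := fun σ => by
    rw [abs_pow, ← mul_pow]
    exact pow_le_pow_left₀ (abs_nonneg _) (ha σ) 2
  have e_ab : ∀ σ : ChainConfig,
      |deriv P.V ((σ 1).1 - (σ 0).1) * deriv P.V ((σ 2).1 - (σ 1).1)| ≤
      c ^ 2 * P.bmLocalEnergy 0 2 σ ^ 2 := fun σ => by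
    rw [abs_mul]
    calc |deriv P.V ((σ 1).1 - (σ 0).1)| * |deriv P.V ((σ 2).1 - (σ 1).1)|
        ≤ (c * P.bmLocalEnergy 0 2 σ) * (c * P.bmLocalEnergy 0 2 σ) :=
          mul_le_mul (ha σ) (hb σ) (abs_nonneg _) (mul_nonneg hc (hW0 σ))
      _ = c ^ 2 * P.bmLocalEnergy 0 2 σ ^ 2 := by ring
  have e_s2 : ∀ σ : ChainConfig,
      |(deriv P.V ((σ 1).1 - (σ 0).1) + deriv P.V ((σ 2).1 - (σ 1).1)) ^ 2| ≤
      (2 * c) ^ 2 * P.bmLocalEnergy 0 2 σ ^ 2 := fun σ => by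
    rw [abs_pow, ← mul_pow]
    refine pow_le_pow_left₀ (abs_nonneg _) ((abs_add_le _ _).trans ?_) 2
    linarith [ha σ, hb σ]
  obtain ⟨ha2, hIa2⟩ := hI (c ^ 2) (fun σ => deriv P.V ((σ 1).1 - (σ 0).1) ^ 2)
    (ham.pow_const 2) e_a2
  obtain ⟨hab, hIab⟩ := hI (c ^ 2)
    (fun σ => deriv P.V ((σ 1).1 - (σ 0).1) * deriv P.V ((σ 2).1 - (σ 1).1)) (ham.mul hbm) e_ab
  obtain ⟨hs2, -⟩ := hI ((2 * c) ^ 2)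
    (fun σ => (deriv P.V ((σ 1).1 - (σ 0).1) + deriv P.V ((σ 2).1 - (σ 1).1)) ^ 2)
    ((ham.add hbm).pow_const 2) e_s2
  -- shift invariance `∫ j_0 j_{-1} = ∫ j_0 j_1`: the left side is the three-term static sum `∑_x ∫ j_0 j_x`
  have hm1 : ∫ σ, P.bondCurrentZ σ 0 * P.bondCurrentZ σ (-1) ∂μ =
      ∫ σ, P.bondCurrentZ σ 0 * P.bondCurrentZ σ 1 ∂μ := by
    rw [← hshift.integral_comp_shift (fun σ => P.bondCurrentZ σ 0 * P.bondCurrentZ σ (-1))]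
    simp only [bondCurrentZ_shift]
    norm_num
    exact integral_congr_ae (Eventually.of_forall fun σ => mul_comm _ _)
  have hsq : ∫ σ, P.bondCurrentZ σ 0 ^ 2 ∂μ = ∫ σ, P.bondCurrentZ σ 0 * P.bondCurrentZ σ 0 ∂μ :=
    integral_congr_ae (Eventually.of_forall fun σ => pow_two _)
  have hsum : (∫ σ, P.bondCurrentZ σ 0 ^ 2 ∂μ) + 2 * ∫ σ, P.bondCurrentZ σ 0 * P.bondCurrentZ σ 1 ∂μ =
      ∑' x : ℤ, ∫ σ, P.bondCurrentZ σ 0 * P.bondCurrentZ σ x ∂μ := by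
    rw [hμ.tsum_integral_bondCurrentZ_mul, hm1, hsq]
    ring
  rw [hsum, hμ.tsum_integral_bondCurrentZ_mul_eq hU hV hT hshift
    (fun i j h1 h2 h3 h4 => hIa2 i j (by omega) (by omega) (by omega) (by omega))
    (fun i j h1 h2 h3 h4 => hIab i j (by omega) h2 (by omega) h4) ha2 hab]
  -- positivity: the integrand vanishes only on the null event `{q_0 = q_2}`
  refine mul_pos (by positivity) ?_
  rw [integral_pos_iff_support_of_nonneg_ae (Eventually.of_forall fun σ => sq_nonneg _) hs2]
  have hS : MeasurableSet {σ : ChainConfig | (σ 0).1 = (σ 2).1} :=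
    measurableSet_eq_fun (hq 0) (hq 2)
  have hone : μ {σ : ChainConfig | (σ 0).1 = (σ 2).1}ᶜ = 1 :=
    (prob_compl_eq_one_iff hS).2 (hμ.measure_fst_eq_fst (by norm_num))
  have hsub : {σ : ChainConfig | (σ 0).1 = (σ 2).1}ᶜ ⊆ Function.support fun σ : ChainConfig =>
      (deriv P.V ((σ 1).1 - (σ 0).1) + deriv P.V ((σ 2).1 - (σ 1).1)) ^ 2 := by
    intro σ hσ h0
    have h := hVinj _ _ ((pow_eq_zero_iff two_ne_zero).1 h0)
    exact hσ (by show (σ 0).1 = (σ 2).1; linarith)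
  calc (0 : ℝ≥0∞) < 1 := one_pos
    _ = μ {σ : ChainConfig | (σ 0).1 = (σ 2).1}ᶜ := hone.symm
    _ ≤ μ (Function.support fun σ : ChainConfig =>
        (deriv P.V ((σ 1).1 - (σ 0).1) + deriv P.V ((σ 2).1 - (σ 1).1)) ^ 2) := measure_mono hsub

/-- **NC `gibbs_currentAutocov_three_pos`** (registered stub of the birth line of `LocalOhmBV.LocalOhm`,
verbatim): the three-bond static current covariance is positive (any `lam, β ≥ 0`):
`∫ j_0² dμ + 2 ∫ j_0 j_1 dμ = (T/4) ∫ (V'(r_0) + V'(r_1))² dμ > 0` for `P = pinnedChain ω₂ lam β γ`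
(`ω₂ > 0`, `lam, β ≥ 0`), `T > 0` and every shift-invariant DLR Gibbs state `μ` at `T`. Instance of
`integral_bondCurrentZ_sq_add_two_mul_pos`: `U ≥ 0` continuous, `V` an even polynomial of degree `2` or `4`
(`exists_isEvenPolyOfDegree_V_pinnedChain`), `V'(r) = r + βr³` odd-injective
(`pinnedChain_deriv_V_add_eq_zero`), and every shift-invariant DLR state of the pinned chain is superstable
(`hasSuperstabilityEstimate_of_isShiftInvariant_pinnedChain`). [folklore] -/
theorem gibbs_currentAutocov_three_pos :
    ∀ ω₂ lam β γ : ℝ, 0 < ω₂ → 0 ≤ lam → 0 ≤ β → ∀ T : ℝ, 0 < T →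
    ∀ μ : Measure ChainConfig, (pinnedChain ω₂ lam β γ).IsChainGibbsMeasure T μ → IsShiftInvariant μ →
    0 < (∫ σ, (pinnedChain ω₂ lam β γ).bondCurrentZ σ 0 ^ 2 ∂μ) +
      2 * ∫ σ, (pinnedChain ω₂ lam β γ).bondCurrentZ σ 0 * (pinnedChain ω₂ lam β γ).bondCurrentZ σ 1 ∂μ := by
  intro ω₂ lam β γ hω hl hβ T hT μ hμ hS
  obtain ⟨s₂, hs₂, hVp⟩ := exists_isEvenPolyOfDegree_V_pinnedChain ω₂ lam γ hβ
  have hU : Continuous (pinnedChain ω₂ lam β γ).U := by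
    show Continuous fun q : ℝ => ω₂ * q ^ 2 / 2 + lam * q ^ 4 / 4
    fun_prop
  exact integral_bondCurrentZ_sq_add_two_mul_pos hs₂ (OscillatorChain.pinnedChain_U_nonneg β γ hω.le hl) hU
    hVp (pinnedChain_deriv_V_add_eq_zero γ hβ) hT hμ hS
    (OscillatorChain.hasSuperstabilityEstimate_of_isShiftInvariant_pinnedChain γ hω hl hβ hT hμ hS)

end Summit.AtomisticToContinuum.FouriersLaw.Theorems.LocalOhmBirth

end
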